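import Summits.Ventures.Crystal3D.Theorems.StickyWulffConstantCoaxialWallLawPayerTwinCellExportNm
import Summits.Ventures.Crystal3D.Theorems.StickyWulffConstantCoaxialWallLawEndRowPattern
import HarnessLib

/-!
# End accounting, multi-source V‴: the TOP plate's pooled end pairs pulled back, with the census-row datum per pair

HONEST FRAMING. Venture `Summits/Ventures/Crystal3D` (cell `crystal3d-full`), helper for the crux `CoaxialWallLaw`
(stmt-Ventures-19481, line `WallLedgerF`, stub `stub_coaxialTwoSlabAdhesion`).  Rung credit only; F-C1 not moved.  STEP-2 of
cf-p1 (xxxiii), 19481-p2 g6: `wordNet_twin_endPairs_top` (`…PayerTwinCellTop`) VERBATIM, fed by the `…Nm` export, and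
exporting per pulled-back pair ALSO the census-row datum: an admissible class `(G, d)` of the TOP plate system
`⟨F true, falling in-plane roots⟩` (`PlateSystem.Adm`) with `IsEndMove X v1 G d q b` (`…EndRowDefs`), obtained from the
mirrored cell's witness by `isEndMove_of_nm` and `isEndMove_transport` (`…EndRowPattern`).  * `wordNet_twin_endPairs_top_nm`.
WHAT THIS IS NOT: the two-plate row cell (next); F-C1 not moved.
-/

noncomputable section

namespace Summit.Ventures.Crystal3D.Theorems

open Summit.Ventures.Crystal3D Finset
open Literature.MathematicalPhysics.StatisticalMechanics (fccStacking)
open scoped InnerProductSpace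

open scoped Classical in
/-- **The top plate's pooled end pairs in the bottom system, with the census-row datum.**  See the module docstring. -/
theorem wordNet_twin_endPairs_top_nm {δ : ℝ} (hg : KissingGap δ) (hc : KissingClassification δ)
    (L : EuclideanSpace ℝ (Fin 3) ≃ₗᵢ[ℝ] EuclideanSpace ℝ (Fin 3))
    (F : Bool → (EuclideanSpace ℝ (Fin 3) ≃ₗᵢ[ℝ] EuclideanSpace ℝ (Fin 3)))
    (hF : (F false = L ∧ F true = (ℝ ∙ EuclideanSpace.single (2 : Fin 3) (1 : ℝ)).reflection.trans L) ∨
      (F false = (ℝ ∙ EuclideanSpace.single (2 : Fin 3) (1 : ℝ)).reflection.trans L ∧ F true = L))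
    {n : EuclideanSpace ℝ (Fin 3)}
    (hn : n = L (EuclideanSpace.single (2 : Fin 3) (1 : ℝ)) ∨ n = -L (EuclideanSpace.single (2 : Fin 3) (1 : ℝ)))
    (s₁ s₂ : EuclideanSpace ℝ (Fin 3)) (X P₁ P₂ : Finset (EuclideanSpace ℝ (Fin 3))) (R₀ h ρ : ℝ)
    (hR₀ : 10 ≤ R₀) (hh : 0 ≤ h) (hρ : R₀ ≤ ρ)
    (hX : ∀ p ∈ X, ∀ q ∈ X, p ≠ q → 1 ≤ dist p q)
    (hcell : ∀ p ∈ X, -(2 * R₀) ≤ p 2 ∧ p 2 ≤ h + 2 * R₀ ∧ p 0 ^ 2 + p 1 ^ 2 ≤ ρ ^ 2)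
    (hP₁X : P₁ ⊆ X) (hP₂X : P₂ ⊆ X)
    (hP₁ : ∀ p, p ∈ P₁ ↔ (p ∈ (fun q => F false q + s₁) '' fccStacking 1 (Real.sqrt (2 / 3)) ∧
      -(2 * R₀) ≤ p 2 ∧ p 2 ≤ -R₀ ∧ p 0 ^ 2 + p 1 ^ 2 ≤ ρ ^ 2))
    (hP₂ : ∀ p, p ∈ P₂ ↔ (p ∈ (fun q => F true q + s₂) '' fccStacking 1 (Real.sqrt (2 / 3)) ∧
      h + R₀ ≤ p 2 ∧ p 2 ≤ h + 2 * R₀ ∧ p 0 ^ 2 + p 1 ^ 2 ≤ ρ ^ 2)) :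
    ∃ Fw : List (EuclideanSpace ℝ (Fin 3)) → (EuclideanSpace ℝ (Fin 3) ≃ₗᵢ[ℝ] EuclideanSpace ℝ (Fin 3)),
      Fw [] = F false ∧ (∀ μ κ, Fw (μ :: κ) = ((ℝ ∙ μ)ᗮ.reflection).trans (Fw κ)) ∧
      ∃ T : Finset (EuclideanSpace ℝ (Fin 3) × EuclideanSpace ℝ (Fin 3)),
      Real.sqrt 2 * (∑ r ∈ fccSlots.filter (fun r => ⟪F false r, n⟫_ℝ = 0 ∧ 0 < (F false r) 2), (F false r) 2) *
          Real.pi * ρ ^ 2 - 12 * (12 * Real.sqrt 2 * Real.pi + 36 * R₀ + 55440) * ρ ≤ (T.card : ℝ) ∧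
      (∀ bq ∈ T, bq.1 ∈ X ∧ bq.2 ∈ X ∧ dist bq.1 bq.2 = 1 ∧ -R₀ - 1 ≤ bq.1 2 ∧ bq.1 2 ≤ h + R₀ + 1) ∧
      (∀ bq ∈ T, (X.filter fun q => dist bq.1 q = 1).card ≤ 11 ∨
        ∃ z₁ ∈ X, ∃ z₂ ∈ X, z₁ ≠ z₂ ∧ dist bq.1 z₁ = 1 ∧ dist bq.1 z₂ = 1 ∧
          (X.filter fun q => dist z₁ q = 1).card ≤ 11 ∧ (X.filter fun q => dist z₂ q = 1).card ≤ 11) ∧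
      (∀ bq ∈ T, ∃ r ∈ fccSlots.filter (fun r => ⟪F false r, n⟫_ℝ = 0 ∧ 0 < (F false r) 2),
        ∃ κ : List (EuclideanSpace ℝ (Fin 3)),
        (∀ μ ∈ κ, ‖μ‖ = 1 ∧
          ∀ w ∈ fccSlots, ⟪w, μ⟫_ℝ = 0 ∨ ⟪w, μ⟫_ℝ = Real.sqrt (2 / 3) ∨ ⟪w, μ⟫_ℝ = -Real.sqrt (2 / 3)) ∧
        List.IsChain (fun μ μ' => ⟪μ, μ'⟫_ℝ = 1 / 3 ∨ ⟪μ, μ'⟫_ℝ = -1 / 3) κ ∧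
        (∃ l : List (EuclideanSpace ℝ (Fin 3)), κ = l ++ [EuclideanSpace.single (2 : Fin 3) (1 : ℝ)]) ∧
        (((∀ w ∈ fccSlots, bq.2 + Fw κ w ∈ X) ∧ bq.1 = bq.2 + Fw κ (((-1 : ℝ) ^ κ.length) • r)) ∨
          ∃ m : EuclideanSpace ℝ (Fin 3), ‖m‖ = 1 ∧
            (∀ w ∈ fccSlots, ⟪Fw κ w, m⟫_ℝ = 0 ∨ ⟪Fw κ w, m⟫_ℝ = Real.sqrt (2 / 3) ∨ ⟪Fw κ w, m⟫_ℝ = -Real.sqrt (2 / 3)) ∧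
            (∀ w ∈ fccSlots, ⟪Fw κ w, m⟫_ℝ ≤ 0 → bq.2 + Fw κ w ∈ X) ∧
            (∀ w ∈ fccSlots, ⟪Fw κ w, m⟫_ℝ < 0 → bq.2 + (Fw κ w - (2 * ⟪Fw κ w, m⟫_ℝ) • m) ∈ X) ∧
            (∀ w ∈ fccSlots, 0 < ⟪Fw κ w, m⟫_ℝ → bq.2 + Fw κ w ∉ X) ∧
            ((⟪Fw κ (((-1 : ℝ) ^ κ.length) • r), m⟫_ℝ = Real.sqrt (2 / 3) ∧
                bq.1 = bq.2 - (Fw κ (((-1 : ℝ) ^ κ.length) • r) -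
                  (2 * ⟪Fw κ (((-1 : ℝ) ^ κ.length) • r), m⟫_ℝ) • m)) ∨
              (⟪Fw κ (((-1 : ℝ) ^ κ.length) • r), m⟫_ℝ = 0 ∧ bq.1 = bq.2 + Fw κ (((-1 : ℝ) ^ κ.length) • r))))) ∧
      (∀ bq ∈ T, ∃ (G : EuclideanSpace ℝ (Fin 3) ≃ₗᵢ[ℝ] EuclideanSpace ℝ (Fin 3)) (d : EuclideanSpace ℝ (Fin 3)),
        PlateSystem.Adm ⟨F true, inPlaneRoots (F true) (-1)⟩ G d ∧ IsEndMove X WordVersion.v1 G d bq.2 bq.1) := by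
  have he₃1 : ‖(EuclideanSpace.single (2 : Fin 3) (1 : ℝ) : EuclideanSpace ℝ (Fin 3))‖ = 1 := by
    rw [PiLp.norm_single, norm_one]
  have hFR : ∀ x, F false x = F true ((ℝ ∙ EuclideanSpace.single (2 : Fin 3) (1 : ℝ)).reflection x) := by
    intro x
    rcases hF with ⟨h0, h1⟩ | ⟨h0, h1⟩ <;> rw [h0, h1, LinearIsometryEquiv.trans_apply]
    rw [Submodule.reflection_reflection]
  have hFR' : ∀ x, F true x = F false ((ℝ ∙ EuclideanSpace.single (2 : Fin 3) (1 : ℝ)).reflection x) := by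
    intro x; rw [hFR, Submodule.reflection_reflection]
  set S : EuclideanSpace ℝ (Fin 3) ≃ₗᵢ[ℝ] EuclideanSpace ℝ (Fin 3) :=
    ((ℝ ∙ EuclideanSpace.single (2 : Fin 3) (1 : ℝ)).reflection).trans (LinearIsometryEquiv.neg ℝ) with hS
  have hS_apply : ∀ p, S p = -((ℝ ∙ EuclideanSpace.single (2 : Fin 3) (1 : ℝ)).reflection p) := fun p => rfl
  have hS0 : ∀ p : EuclideanSpace ℝ (Fin 3), S p 0 = p 0 := by
    intro p; rw [hS_apply, PiLp.neg_apply, (halfTurn_coord p).1, neg_neg]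
  have hS1 : ∀ p : EuclideanSpace ℝ (Fin 3), S p 1 = p 1 := by
    intro p; rw [hS_apply, PiLp.neg_apply, (halfTurn_coord p).2.1, neg_neg]
  have hS2 : ∀ p : EuclideanSpace ℝ (Fin 3), S p 2 = -p 2 := by
    intro p; rw [hS_apply, PiLp.neg_apply, (halfTurn_coord p).2.2]
  have hSS : ∀ p, S (S p) = p := by
    intro p
    ext l
    fin_cases l
    · simp only [Fin.zero_eta, Fin.isValue]; rw [hS0, hS0]
    · simp only [Fin.mk_one, Fin.isValue]; rw [hS1, hS1]
    · simp only [Fin.reduceFinMk, Fin.isValue]; rw [hS2, hS2, neg_neg]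
  have hSinner : ∀ a b, ⟪S a, b⟫_ℝ = ⟪a, S b⟫_ℝ := by
    intro a b; rw [← LinearIsometryEquiv.inner_map_map S (S a) b, hSS]
  clear_value S
  set cM : EuclideanSpace ℝ (Fin 3) := h • EuclideanSpace.single (2 : Fin 3) (1 : ℝ) with hcM
  have hc0 : cM 0 = 0 := by simp [hcM]
  have hc1 : cM 1 = 0 := by simp [hcM]
  have hc2 : cM 2 = h := by simp [hcM]
  let M : EuclideanSpace ℝ (Fin 3) → EuclideanSpace ℝ (Fin 3) := fun p => S p + cM
  have hM0 : ∀ p, M p 0 = p 0 := by intro p; simp only [M, PiLp.add_apply, hS0, hc0, add_zero]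
  have hM1 : ∀ p, M p 1 = p 1 := by intro p; simp only [M, PiLp.add_apply, hS1, hc1, add_zero]
  have hM2 : ∀ p, M p 2 = h - p 2 := by intro p; simp only [M, PiLp.add_apply, hS2, hc2]; ring
  have hMM : ∀ p, M (M p) = p := by
    intro p
    have hSc : S cM = -cM := by
      ext l; fin_cases l
      · simp only [Fin.zero_eta, Fin.isValue]; rw [hS0, PiLp.neg_apply, hc0, neg_zero]
      · simp only [Fin.mk_one, Fin.isValue]; rw [hS1, PiLp.neg_apply, hc1, neg_zero]
      · simp only [Fin.reduceFinMk, Fin.isValue]; rw [hS2, PiLp.neg_apply]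
    simp only [M, map_add, hSS, hSc]; abel
  have hMinj : Function.Injective M := fun p q hpq => by
    have := congrArg M hpq; rwa [hMM, hMM] at this
  have hMdist : ∀ p q, dist (M p) (M q) = dist p q := by
    intro p q; simp only [M, dist_add_right, LinearIsometryEquiv.dist_map]
  have hMadd : ∀ p w, M (p + w) = M p + S w := by intro p w; simp only [M, map_add]; abel
  have hMsub : ∀ p w, M (p - w) = M p - S w := by intro p w; simp only [M, map_sub]; abel
  have hMrad : ∀ p, M p 0 ^ 2 + M p 1 ^ 2 = p 0 ^ 2 + p 1 ^ 2 := by intro p; rw [hM0, hM1]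
  set X' := X.image M with hX'
  have hmemX' : ∀ p, p ∈ X' ↔ M p ∈ X := by
    intro p
    rw [hX', mem_image]
    constructor
    · rintro ⟨x, hx, hxp⟩; rw [← hxp, hMM]; exact hx
    · intro hp; exact ⟨M p, hp, hMM p⟩
  have hmemIm : ∀ (Q : Finset (EuclideanSpace ℝ (Fin 3))) p, p ∈ Q.image M ↔ M p ∈ Q := by
    intro Q p
    rw [mem_image]
    constructor
    · rintro ⟨x, hx, hxp⟩; rw [← hxp, hMM]; exact hx
    · intro hp; exact ⟨M p, hp, hMM p⟩
  have hX'sep : ∀ p ∈ X', ∀ q ∈ X', p ≠ q → 1 ≤ dist p q := by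
    intro p hp q hq hpq
    rw [← hMdist]
    exact hX _ ((hmemX' p).1 hp) _ ((hmemX' q).1 hq) (fun h' => hpq (hMinj h'))
  have hcell' : ∀ p ∈ X', -(2 * R₀) ≤ p 2 ∧ p 2 ≤ h + 2 * R₀ ∧ p 0 ^ 2 + p 1 ^ 2 ≤ ρ ^ 2 := by
    intro p hp
    obtain ⟨h1, h2, h3⟩ := hcell _ ((hmemX' p).1 hp)
    rw [hM2] at h1 h2; rw [hMrad] at h3
    exact ⟨by linarith, by linarith, h3⟩
  set F' : Bool → (EuclideanSpace ℝ (Fin 3) ≃ₗᵢ[ℝ] EuclideanSpace ℝ (Fin 3)) := fun c => (F (!c)).trans S with hF'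
  have hF'f : ∀ x, F' false x = S (F true x) := fun x => rfl
  have hF't : ∀ x, F' true x = S (F false x) := fun x => rfl
  have hcc : ∀ (c : Bool) (q : EuclideanSpace ℝ (Fin 3)), F' (!c) q = S (F c q) := by
    intro c; cases c
    · exact fun q => hF't q
    · exact fun q => hF'f q
  clear_value F'
  have hF'norm : F' false = F' false ∧ F' true = (ℝ ∙ EuclideanSpace.single (2 : Fin 3) (1 : ℝ)).reflection.trans (F' false) := by
    refine ⟨rfl, LinearIsometryEquiv.ext fun x => ?_⟩
    rw [LinearIsometryEquiv.trans_apply, hF't, hF'f, hFR]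
  have hRe₃ : (ℝ ∙ EuclideanSpace.single (2 : Fin 3) (1 : ℝ)).reflection (EuclideanSpace.single (2 : Fin 3) (1 : ℝ)) =
      EuclideanSpace.single (2 : Fin 3) (1 : ℝ) :=
    Submodule.reflection_mem_subspace_eq_self (Submodule.mem_span_singleton_self _)
  have hFte₃ : F true (EuclideanSpace.single (2 : Fin 3) (1 : ℝ)) = L (EuclideanSpace.single (2 : Fin 3) (1 : ℝ)) := by
    rcases hF with ⟨-, h1⟩ | ⟨-, h1⟩ <;> rw [h1]
    rw [LinearIsometryEquiv.trans_apply, hRe₃]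
  have hn' : S n = F' false (EuclideanSpace.single (2 : Fin 3) (1 : ℝ)) ∨
      S n = -F' false (EuclideanSpace.single (2 : Fin 3) (1 : ℝ)) := by
    rw [hF'f, hFte₃]
    rcases hn with h0 | h0
    · exact Or.inl (by rw [h0])
    · exact Or.inr (by rw [h0, map_neg])
  have hlat : ∀ (c : Bool) (s p : EuclideanSpace ℝ (Fin 3)),
      M p ∈ (fun q => F c q + s) '' fccStacking 1 (Real.sqrt (2 / 3)) ↔
        p ∈ (fun q => F' (!c) q + M s) '' fccStacking 1 (Real.sqrt (2 / 3)) := by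
    intro c s p
    simp only [Set.mem_image, hcc]
    constructor
    · rintro ⟨q, hq, hqp⟩
      refine ⟨q, hq, ?_⟩
      have hqp' : s + F c q = M p := by rw [add_comm]; exact hqp
      have := congrArg M hqp'
      rw [hMM, hMadd] at this
      rw [add_comm]; exact this
    · rintro ⟨q, hq, hqp⟩
      refine ⟨q, hq, ?_⟩
      rw [← hqp, show S (F c q) + M s = M (s + F c q) by rw [hMadd, add_comm], hMM, add_comm]
  have hlat_t : ∀ p, M p ∈ (fun q => F true q + s₂) '' fccStacking 1 (Real.sqrt (2 / 3)) ↔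
      p ∈ (fun q => F' false q + M s₂) '' fccStacking 1 (Real.sqrt (2 / 3)) := fun p => hlat true s₂ p
  have hlat_f : ∀ p, M p ∈ (fun q => F false q + s₁) '' fccStacking 1 (Real.sqrt (2 / 3)) ↔
      p ∈ (fun q => F' true q + M s₁) '' fccStacking 1 (Real.sqrt (2 / 3)) := fun p => hlat false s₁ p
  have hP₁' : ∀ p, p ∈ P₂.image M ↔ (p ∈ (fun q => F' false q + M s₂) '' fccStacking 1 (Real.sqrt (2 / 3)) ∧
      -(2 * R₀) ≤ p 2 ∧ p 2 ≤ -R₀ ∧ p 0 ^ 2 + p 1 ^ 2 ≤ ρ ^ 2) := by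
    intro p
    rw [hmemIm, hP₂, hM2, hMrad, hlat_t]
    constructor
    · rintro ⟨h1, h2, h3, h4⟩; exact ⟨h1, by linarith, by linarith, h4⟩
    · rintro ⟨h1, h2, h3, h4⟩; exact ⟨h1, by linarith, by linarith, h4⟩
  have hP₂' : ∀ p, p ∈ P₁.image M ↔ (p ∈ (fun q => F' true q + M s₁) '' fccStacking 1 (Real.sqrt (2 / 3)) ∧
      h + R₀ ≤ p 2 ∧ p 2 ≤ h + 2 * R₀ ∧ p 0 ^ 2 + p 1 ^ 2 ≤ ρ ^ 2) := by
    intro p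
    rw [hmemIm, hP₁, hM2, hMrad, hlat_f]
    constructor
    · rintro ⟨h1, h2, h3, h4⟩; exact ⟨h1, by linarith, by linarith, h4⟩
    · rintro ⟨h1, h2, h3, h4⟩; exact ⟨h1, by linarith, by linarith, h4⟩
  have hP₁'X : P₂.image M ⊆ X' := image_subset_image hP₂X
  have hP₂'X : P₁.image M ⊆ X' := image_subset_image hP₁X
  obtain ⟨Fw', hF0', hFc', T', hflux', hTpair', hTpay', hTwit'⟩ :=
    wordNet_twin_endPairs_multi_nm hg hc (F' false) F' (Or.inl hF'norm) hn' (M s₂) (M s₁) X' (P₂.image M) (P₁.image M)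
      R₀ h ρ hR₀ hh hρ hX'sep hcell' hP₁'X hP₂'X hP₁' hP₂'
  have hax : ∀ w, ⟪F false w, n⟫_ℝ = 0 ↔ w 2 = 0 := by
    intro w
    have h0 : ⟪F false w, L (EuclideanSpace.single (2 : Fin 3) (1 : ℝ))⟫_ℝ = w 2 := by
      rcases hF with ⟨h0, -⟩ | ⟨h0, -⟩ <;> rw [h0]
      · exact inner_frame_axis L w
      · exact inner_twinFrame_axis L w
    rcases hn with h' | h'
    · rw [h', h0]
    · rw [h', inner_neg_right, h0, neg_eq_zero]
  have hFt : ∀ w : EuclideanSpace ℝ (Fin 3), w 2 = 0 → F true w = -F false w := by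
    intro w hw
    rw [hFR', halfTurn_apply, hw, mul_zero, zero_smul, zero_sub, map_neg]
  have hRTeq : fccSlots.filter (fun r => ⟪F' false r, S n⟫_ℝ = 0 ∧ 0 < (F' false r) 2) =
      fccSlots.filter (fun r => ⟪F false r, n⟫_ℝ = 0 ∧ 0 < (F false r) 2) := by
    refine filter_congr fun r _ => ?_
    rw [hF'f, LinearIsometryEquiv.inner_map_map, hS2]
    constructor
    · rintro ⟨h1, h2⟩
      have hr2 : r 2 = 0 := by
        rw [hFR'] at h1
        have := (hax _).1 h1
        rwa [(halfTurn_coord r).2.2] at this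
      rw [hFt r hr2, PiLp.neg_apply, neg_neg] at h2
      exact ⟨(hax r).2 hr2, h2⟩
    · rintro ⟨h1, h2⟩
      have hr2 : r 2 = 0 := (hax r).1 h1
      refine ⟨?_, by rw [hFt r hr2, PiLp.neg_apply, neg_neg]; exact h2⟩
      rw [hFt r hr2, inner_neg_left, h1, neg_zero]
  have hsum : ∑ r ∈ fccSlots.filter (fun r => ⟪F' false r, S n⟫_ℝ = 0 ∧ 0 < (F' false r) 2), (F' false r) 2 =
      ∑ r ∈ fccSlots.filter (fun r => ⟪F false r, n⟫_ℝ = 0 ∧ 0 < (F false r) 2), (F false r) 2 := by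
    rw [hRTeq]
    refine sum_congr rfl fun r hr => ?_
    have hr2 : r 2 = 0 := (hax r).1 (mem_filter.1 hr).2.1
    rw [hF'f, hS2, hFt r hr2, PiLp.neg_apply, neg_neg]
  rw [hsum] at hflux'
  set Fw : List (EuclideanSpace ℝ (Fin 3)) → (EuclideanSpace ℝ (Fin 3) ≃ₗᵢ[ℝ] EuclideanSpace ℝ (Fin 3)) :=
    fun κ => κ.foldr (fun μ G => ((ℝ ∙ μ)ᗮ.reflection).trans G) (F false) with hFw
  have hF0 : Fw [] = F false := rfl
  have hFc : ∀ μ κ, Fw (μ :: κ) = ((ℝ ∙ μ)ᗮ.reflection).trans (Fw κ) := fun _ _ => rfl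
  clear_value Fw
  have hconv : ∀ (κ : List (EuclideanSpace ℝ (Fin 3))) (x : EuclideanSpace ℝ (Fin 3)),
      S (Fw' κ x) = -Fw (κ ++ [EuclideanSpace.single (2 : Fin 3) (1 : ℝ)]) x := by
    intro κ
    induction κ with
    | nil =>
      intro x
      rw [hF0', hF'f, hSS, List.nil_append, hFc, hF0, LinearIsometryEquiv.trans_apply, reflection_unit_apply he₃1, hFR',
        halfTurn_apply, ← apply_two_eq_inner_e₃]
      rw [show (2 * x 2) • EuclideanSpace.single (2 : Fin 3) (1 : ℝ) - x =
        -(x - (2 * x 2) • EuclideanSpace.single (2 : Fin 3) (1 : ℝ)) by abel, map_neg]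
    | cons μ κ ih =>
      intro x
      rw [hFc', LinearIsometryEquiv.trans_apply, ih, List.cons_append, hFc, LinearIsometryEquiv.trans_apply]
  set T : Finset (EuclideanSpace ℝ (Fin 3) × EuclideanSpace ℝ (Fin 3)) := T'.image (fun bq => (M bq.1, M bq.2)) with hT
  have hPinj : Function.Injective (fun bq : EuclideanSpace ℝ (Fin 3) × EuclideanSpace ℝ (Fin 3) => (M bq.1, M bq.2)) := by
    intro a b hab
    simp only [Prod.mk.injEq] at hab
    exact Prod.ext (hMinj hab.1) (hMinj hab.2)
  have hTcard : T.card = T'.card := card_image_of_injective _ hPinj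
  have hdeg : ∀ b, (X'.filter fun q => dist b q = 1).card = (X.filter fun q => dist (M b) q = 1).card := by
    intro b
    have : (X.filter fun q => dist (M b) q = 1) = (X'.filter fun q => dist b q = 1).image M := by
      ext q
      rw [mem_filter, mem_image]
      constructor
      · rintro ⟨hq, hd⟩
        refine ⟨M q, mem_filter.2 ⟨(hmemX' _).2 (by rw [hMM]; exact hq), ?_⟩, hMM q⟩
        rw [← hMdist, hMM]; exact hd
      · rintro ⟨q', hq', rfl⟩
        obtain ⟨hq'X, hd⟩ := mem_filter.1 hq'
        exact ⟨(hmemX' q').1 hq'X, by rw [hMdist]; exact hd⟩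
    rw [this, card_image_of_injective _ hMinj]
  refine ⟨Fw, hF0, hFc, T, by rw [hTcard]; exact hflux', ?_, ?_, ?_, ?_⟩
  · intro bq hbq
    obtain ⟨bq', hbq', rfl⟩ := mem_image.1 hbq
    obtain ⟨h1, h2, h3, h4, h5⟩ := hTpair' bq' hbq'
    refine ⟨(hmemX' _).1 h1, (hmemX' _).1 h2, by rw [hMdist]; exact h3, ?_, ?_⟩
    · show -R₀ - 1 ≤ M bq'.1 2; rw [hM2]; linarith
    · show M bq'.1 2 ≤ h + R₀ + 1; rw [hM2]; linarith
  · intro bq hbq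
    obtain ⟨bq', hbq', rfl⟩ := mem_image.1 hbq
    rcases hTpay' bq' hbq' with h11 | ⟨z₁, hz₁, z₂, hz₂, hne, hd₁, hd₂, hc₁, hc₂⟩
    · left; show (X.filter fun q => dist (M bq'.1) q = 1).card ≤ 11; rw [← hdeg]; exact h11
    · right
      refine ⟨M z₁, (hmemX' _).1 hz₁, M z₂, (hmemX' _).1 hz₂, fun h' => hne (hMinj h'), ?_, ?_, ?_, ?_⟩
      · show dist (M bq'.1) (M z₁) = 1; rw [hMdist]; exact hd₁
      · show dist (M bq'.1) (M z₂) = 1; rw [hMdist]; exact hd₂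
      · rw [← hdeg]; exact hc₁
      · rw [← hdeg]; exact hc₂
  · intro bq hbq
    obtain ⟨bq', hbq', rfl⟩ := mem_image.1 hbq
    obtain ⟨r, hr, κ, -, hlet, hch, hdeep, hpatN⟩ := hTwit' bq' hbq'
    have hpat := endWitness_of_nm hpatN
    rw [hRTeq] at hr
    have hr2 : r 2 = 0 := (hax r).1 (mem_filter.1 hr).2.1
    have hrS : r ∈ fccSlots := (mem_filter.1 hr).1
    set κ'' := κ ++ [EuclideanSpace.single (2 : Fin 3) (1 : ℝ)] with hκ''
    have hlet'' : ∀ μ ∈ κ'', ‖μ‖ = 1 ∧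
        ∀ w ∈ fccSlots, ⟪w, μ⟫_ℝ = 0 ∨ ⟪w, μ⟫_ℝ = Real.sqrt (2 / 3) ∨ ⟪w, μ⟫_ℝ = -Real.sqrt (2 / 3) := by
      intro μ hμ
      rcases List.mem_append.1 hμ with h' | h'
      · exact hlet μ h'
      · rw [List.mem_singleton] at h'; subst h'
        exact ⟨he₃1, fun w hw => by rw [← apply_two_eq_inner_e₃]; exact slot_apply_two_cases hw⟩
    have hch'' : List.IsChain (fun μ μ' => ⟪μ, μ'⟫_ℝ = 1 / 3 ∨ ⟪μ, μ'⟫_ℝ = -1 / 3) κ'' := by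
      rw [hκ'', List.isChain_append]
      refine ⟨hch, List.isChain_singleton _, ?_⟩
      intro x hx y hy
      rw [List.head?_cons, Option.mem_some_iff] at hy
      subst hy
      obtain ⟨l, hl⟩ : ∃ l, κ = l ++ [x] := by
        rcases List.eq_nil_or_concat' κ with h0 | ⟨l, a, h0⟩
        · rw [h0] at hx; simp at hx
        · refine ⟨l, ?_⟩
          rw [h0, List.getLast?_concat, Option.mem_some_iff] at hx
          rw [h0, hx]
      have hxr : ⟪r, x⟫_ℝ = Real.sqrt (2 / 3) := hdeep l x hl
      obtain ⟨hx1, hxm⟩ := hlet x (by rw [hl]; simp)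
      have hr0 : 0 < Real.sqrt (2 / 3) := Real.sqrt_pos.2 (by norm_num)
      have hre₃ : ⟪r, EuclideanSpace.single (2 : Fin 3) (1 : ℝ)⟫_ℝ = 0 := by rw [← apply_two_eq_inner_e₃]; exact hr2
      refine menuNormals_chain_of_ne_of_ne_neg hx1 he₃1 hxm
        (fun w hw => by rw [← apply_two_eq_inner_e₃]; exact slot_apply_two_cases hw) ?_ ?_
      · intro h'; rw [h', hre₃] at hxr; exact hr0.ne hxr
      · intro h'
        have hx' : x = -EuclideanSpace.single (2 : Fin 3) (1 : ℝ) := by rw [h', neg_neg]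
        rw [hx', inner_neg_right, hre₃, neg_zero] at hxr; exact hr0.ne hxr
    have hG : ∀ w, S (Fw' κ w) = -Fw κ'' w := hconv κ
    have hGneg : ∀ w, S (Fw' κ (-w)) = Fw κ'' w := by intro w; rw [hG, map_neg, neg_neg]
    have hlen : ((-1 : ℝ) ^ κ''.length) • r = -((((-1 : ℝ) ^ κ.length) • r)) := by
      rw [hκ'', List.length_append, List.length_singleton, pow_succ, mul_neg_one, neg_smul]
    set d' := Fw' κ (((-1 : ℝ) ^ κ.length) • r) with hd'
    have hdS : S d' = Fw κ'' (((-1 : ℝ) ^ κ''.length) • r) := by rw [hlen, ← hGneg, neg_neg]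
    have hinnS : ∀ a m', ⟪S a, S m'⟫_ℝ = ⟪a, m'⟫_ℝ := fun a m' => LinearIsometryEquiv.inner_map_map S a m'
    refine ⟨r, hr, κ'', hlet'', hch'', ⟨κ, rfl⟩, ?_⟩
    rcases hpat with ⟨hfull, hb⟩ | ⟨m', hm', hmenu', hown', hmir', hemp', htgt'⟩
    · left
      refine ⟨fun w hw => ?_, ?_⟩
      · have := hfull (-w) (neg_mem_fccSlots hw)
        rw [hmemX', hMadd, hGneg] at this
        exact this
      · show M bq'.1 = M bq'.2 + _
        rw [hb, hMadd, ← hdS]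
    · right
      refine ⟨S m', by rw [LinearIsometryEquiv.norm_map, hm'], ?_, ?_, ?_, ?_, ?_⟩
      · intro w hw
        have := hmenu' (-w) (neg_mem_fccSlots hw)
        rwa [← hinnS, hGneg] at this
      · intro w hw hle
        have := hown' (-w) (neg_mem_fccSlots hw) (by rw [← hinnS, hGneg]; exact hle)
        rw [hmemX', hMadd, hGneg] at this
        exact this
      · intro w hw hlt
        have := hmir' (-w) (neg_mem_fccSlots hw) (by rw [← hinnS, hGneg]; exact hlt)
        rw [hmemX', hMadd, map_sub, LinearIsometryEquiv.map_smul, hGneg, ← hinnS (Fw' κ (-w)) m', hGneg] at this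
        exact this
      · intro w hw hpos hmem
        refine hemp' (-w) (neg_mem_fccSlots hw) (by rw [← hinnS, hGneg]; exact hpos) ?_
        rw [hmemX', hMadd, hGneg]; exact hmem
      · rcases htgt' with ⟨hx, hb⟩ | ⟨hx, hb⟩
        · left
          refine ⟨by rw [← hdS, hinnS]; exact hx, ?_⟩
          show M bq'.1 = M bq'.2 - _
          rw [hb, hMsub, map_sub, LinearIsometryEquiv.map_smul, ← hinnS d' m', hdS]
        · right
          refine ⟨by rw [← hdS, hinnS]; exact hx, ?_⟩
          show M bq'.1 = M bq'.2 + _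
          rw [hb, hMadd, hdS]
  · -- the census-row datum: transport the mirrored witness through `M`
    intro bq hbq
    obtain ⟨bq', hbq', rfl⟩ := mem_image.1 hbq
    obtain ⟨r, hr, κ, hWF, -, -, -, hpatN⟩ := hTwit' bq' hbq'
    have hrS : r ∈ fccSlots := (mem_filter.1 hr).1
    have hrup : 0 < (F' false r) 2 := (mem_filter.1 hr).2.2
    rw [hRTeq] at hr
    have hr2 : r 2 = 0 := (hax r).1 (mem_filter.1 hr).2.1
    have hem := isEndMove_of_nm hpatN
    have htr := isEndMove_transport S cM hem
    have hXim : X'.image (fun x => S x + cM) = X := by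
      rw [hX', Finset.image_image]
      have : ((fun x => S x + cM) ∘ M) = id := funext fun p => hMM p
      rw [this, Finset.image_id]
    rw [hXim] at htr
    have hframe : ∀ κ₀ : List (EuclideanSpace ℝ (Fin 3)),
        (Fw' κ₀).trans S = PlateSystem.Fw ⟨F true, inPlaneRoots (F true) (-1)⟩ κ₀ := by
      intro κ₀
      induction κ₀ with
      | nil => rw [hF0']; exact LinearIsometryEquiv.ext fun x => by rw [LinearIsometryEquiv.trans_apply, hF'f, hSS]; rfl
      | cons μ κ₀ ih => rw [hFc', ← LinearIsometryEquiv.trans_assoc, ih]; rfl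
    refine ⟨(Fw' κ).trans S, S (Fw' κ (((-1 : ℝ) ^ κ.length) • r)), ⟨r, ?_, κ, hWF, hframe κ, ?_⟩, htr⟩
    · rw [hF'f, hS2] at hrup
      exact mem_filter.2 ⟨hrS, hr2, by linarith⟩
    · rw [← hframe κ, LinearIsometryEquiv.trans_apply]

end Summit.Ventures.Crystal3D.Theorems

end
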